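import Summits.QuantumFields.YangMills.Theorems.BalabanUVNodesN19UniformMomentsChebyshevRoad
import Mathlib.Analysis.Complex.Trigonometric
import Mathlib.Analysis.SpecificLimits.Normed

/-!
# YM-DAG node N19 (= NE7 proper) — FIXED OBSERVABLES UNDER THE UNIFORM-MOMENT CURRENCY, VII: the Poisson-kernel observables
# `x ↦ (1 − qx)∕(1 − 2qx + q²)` (`|q| < 1`) ride EVERY uniform-geometric sequence absolutely summably (an instance of the Chebyshev road)

Cell `pub-ymgap`, HUMAN RULING D-0062 (Track A) ∕ D-0149 (work-bound push), R141 (C) wider-strategy seat `pub-ymgap-dag-n19-e` (strategy s3 =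
ALTERNATIVE CURRENCY), generation g24, module 7 (lineage module 91; instance file of module 90 `…N19UniformMomentsChebyshevRoad`).  Route
`Summits/QuantumFields/YangMills/Theses/BalabanUVNodes.lean` rev 25, cluster item K3⁷ «SpineGivenEndpointR13SepCoPH» (stmt-QuantumFields-20544); filed
`--supports` that item `--as helper` (it proves no registered stub).  COUNT-NEUTRAL: [folklore] real analysis over Mathlib (complex geometric series
`hasSum_geometric_of_norm_lt_one`, `Complex.hasSum_re`, `exp_ofReal_mul_I_re∕im`, `T_real_cos`, `tsum_coe_mul_geometric_of_norm_lt_one`) + module 90 BY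
NAME; no scheme object, no Theses import; NOT a discharge claim.

§1 ★ THE CHEBYSHEV GENERATING FUNCTION (Poisson kernel): for `|q| < 1` and `x ∈ [−1,1]`, `Σ_j q^j T_j(x) = (1 − qx)∕(1 − 2qx + q²)` (`x = cos θ`,
`T_j(cos θ) = cos(jθ) = Re (qe^{iθ})^j ∕ q^j`, `Σ z^j = 1∕(1−z)`, `Re(1−z)⁻¹ = (1 − q cos θ)∕|1 − z|²`).  §2 ★★ `summable_abs_increments_poissonObs`: along
EVERY sequence of probability laws on `[−1,1]` with all moments `Cθ^K`-close (`C > 0`, `0 < θ < 1`), the observable `g_q(x) = (1 − qx)∕(1 − 2qx + q²)`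
has ABSOLUTELY summable increments, `Σ_K |∫g_q dΛ_{K+1} − ∫g_q dΛ_K| ≤ (2 log 3∕log θ⁻¹)·|q|∕(1−|q|)² + (2(log⁺C∕log θ⁻¹ + 1) + 1∕(1−θ))∕(1−|q|)` — module
90 with `a_j = q^j` (`Σ|a_j| = 1∕(1−|q|)`, `Σ j|a_j| = |q|∕(1−|q|)²`).  A genuinely non-polynomial (rational, pole at `(1+q²)∕2q ∉ [−1,1]`) fixed observable
for which the every-sequence question (HOME `CURRENCY-MAP.md` v3 (w′)) is settled positively; general Lipschitz observables remain open off the arc chains.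

HONEST FRAMING (binding).  Elementary and [folklore]; toy laws, no scheme object; NO consumer in the DAG today; nothing of Bałaban's instantiated; NE7 NOT
PRINTED, NOT proved; N19 NOT discharged; count-neutral.  One finite `T⁴` programme at fixed `ε`; nothing continuum ∕ `ℝ⁴` ∕ OS ∕ mass-gap ∕ Clay.
0 `def` ∕ 0 `sorry`.
-/

noncomputable section

open Real Finset MeasureTheory ProbabilityTheory Polynomial Polynomial.Chebyshev

namespace Summit.QuantumFields.YangMills.Theorems.BalabanUVNodesN19UniformMomentsChebyshevRoadPoisson

open Summit.QuantumFields.YangMills.Theorems.BalabanUVNodesN19UniformMomentsChebyshevRoad (summable_abs_increments_of_chebyshev)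

/-! ## §1 The Chebyshev generating function `Σ q^j T_j(x) = (1 − qx)∕(1 − 2qx + q²)` [folklore] -/

/-- The Poisson cosine series: `Σ_j q^j cos(jθ) = (1 − q cos θ)∕(1 − 2q cos θ + q²)` for `|q| < 1` (real part of the geometric series of `qe^{iθ}`). [folklore] -/
theorem hasSum_pow_mul_cos {q : ℝ} (hq : |q| < 1) (θ : ℝ) :
    HasSum (fun j : ℕ => q ^ j * Real.cos (j * θ)) ((1 - q * Real.cos θ) / (1 - 2 * q * Real.cos θ + q ^ 2)) := by
  set z : ℂ := (q : ℂ) * Complex.exp ((θ : ℂ) * Complex.I) with hz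
  have hzn : ‖z‖ < 1 := by
    rw [hz, norm_mul, Complex.norm_real, Complex.norm_exp_ofReal_mul_I, mul_one, Real.norm_eq_abs]
    exact hq
  have hgeo := hasSum_geometric_of_norm_lt_one hzn
  have hre := Complex.hasSum_re hgeo
  -- the terms: `Re z^j = q^j cos(jθ)`
  have hterm : ∀ j : ℕ, (z ^ j).re = q ^ j * Real.cos (j * θ) := by
    intro j
    rw [hz, mul_pow, ← Complex.exp_nat_mul, show ((j : ℕ) : ℂ) * ((θ : ℂ) * Complex.I) = ((j * θ : ℝ) : ℂ) * Complex.I by push_cast; ring,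
      ← Complex.ofReal_pow, Complex.re_ofReal_mul, Complex.exp_ofReal_mul_I_re]
  -- the sum: `Re (1 − z)⁻¹ = (1 − q cos θ)∕(1 − 2q cos θ + q²)`
  have hzre : z.re = q * Real.cos θ := by rw [hz, Complex.re_ofReal_mul, Complex.exp_ofReal_mul_I_re]
  have hzim : z.im = q * Real.sin θ := by rw [hz, Complex.im_ofReal_mul, Complex.exp_ofReal_mul_I_im]
  have hval : ((1 - z)⁻¹).re = (1 - q * Real.cos θ) / (1 - 2 * q * Real.cos θ + q ^ 2) := by
    rw [Complex.inv_re, Complex.normSq_apply]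
    simp only [Complex.sub_re, Complex.one_re, Complex.sub_im, Complex.one_im, hzre, hzim, zero_sub]
    congr 1
    nlinarith [Real.sin_sq_add_cos_sq θ]
  simp_rw [hterm] at hre
  rwa [hval] at hre

/-- ★ **THE CHEBYSHEV GENERATING FUNCTION**: for `|q| < 1` and `x ∈ [−1,1]`, `Σ_j q^j T_j(x) = (1 − qx)∕(1 − 2qx + q²)`. [folklore] -/
theorem hasSum_pow_mul_T {q : ℝ} (hq : |q| < 1) {x : ℝ} (hx : x ∈ Set.Icc (-1 : ℝ) 1) :
    HasSum (fun j : ℕ => q ^ j * (T ℝ j).eval x) ((1 - q * x) / (1 - 2 * q * x + q ^ 2)) := by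
  have hcos : Real.cos (Real.arccos x) = x := Real.cos_arccos hx.1 hx.2
  have h := hasSum_pow_mul_cos hq (Real.arccos x)
  rw [hcos] at h
  have e : (fun j : ℕ => q ^ j * Real.cos (j * Real.arccos x)) = fun j : ℕ => q ^ j * (T ℝ j).eval x := by
    funext j
    rw [← hcos, Polynomial.Chebyshev.T_real_cos, hcos]
    push_cast
    ring_nf
  rw [e] at h
  exact h

/-! ## §2 The Poisson observables ride every uniform-geometric sequence absolutely summably [folklore] -/

/-- ★★ **THE POISSON OBSERVABLES CONVERGE ABSOLUTELY ALONG EVERY UNIFORM-GEOMETRIC SEQUENCE.**  For probability laws `Λ_K` on `[−1,1]` with ALL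
moments `Cθ^K`-close step to step (`C > 0`, `0 < θ < 1`) and `|q| < 1`, the increments of `g_q(x) = (1 − qx)∕(1 − 2qx + q²)` are summable, with
`Σ_K |∫g_q dΛ_{K+1} − ∫g_q dΛ_K| ≤ (2 log 3∕log θ⁻¹)·|q|∕(1−|q|)² + (2(log⁺C∕log θ⁻¹ + 1) + 1∕(1−θ))∕(1−|q|)` (module 90 at `a_j = q^j`). [folklore] -/
theorem summable_abs_increments_poissonObs {Λ : ℕ → Measure ℝ} [∀ K, IsProbabilityMeasure (Λ K)]
    (hΛ : ∀ K, Λ K (Set.Icc (-1 : ℝ) 1)ᶜ = 0) {C θ : ℝ} (hC : 0 < C) (hθ0 : 0 < θ) (hθ1 : θ < 1)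
    (hmom : ∀ K i : ℕ, |∫ x, x ^ i ∂Λ (K + 1) - ∫ x, x ^ i ∂Λ K| ≤ C * θ ^ K) {q : ℝ} (hq : |q| < 1) :
    Summable (fun K => |∫ x, (1 - q * x) / (1 - 2 * q * x + q ^ 2) ∂Λ (K + 1) - ∫ x, (1 - q * x) / (1 - 2 * q * x + q ^ 2) ∂Λ K|) ∧
      ∑' K, |∫ x, (1 - q * x) / (1 - 2 * q * x + q ^ 2) ∂Λ (K + 1) - ∫ x, (1 - q * x) / (1 - 2 * q * x + q ^ 2) ∂Λ K| ≤
        (2 * Real.log 3 / Real.log θ⁻¹) * (|q| / (1 - |q|) ^ 2) +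
          (2 * (Real.posLog C / Real.log θ⁻¹ + 1) + 1 / (1 - θ)) * (1 / (1 - |q|)) := by
  have hqn : ‖q‖ < 1 := by rwa [Real.norm_eq_abs]
  have ha : Summable fun j : ℕ => |q ^ j| := by
    simp_rw [abs_pow]; exact summable_geometric_of_lt_one (abs_nonneg q) hq
  have ha1 : Summable fun j : ℕ => (j : ℝ) * |q ^ j| := by
    simp_rw [abs_pow]
    have h := summable_pow_mul_geometric_of_norm_lt_one 1 (show ‖|q|‖ < 1 by rwa [Real.norm_eq_abs, abs_abs])
    simpa only [pow_one] using h
  obtain ⟨hS, hT⟩ := summable_abs_increments_of_chebyshev hΛ hC hθ0 hθ1 hmom ha ha1 (fun x hx => hasSum_pow_mul_T hq hx)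
  refine ⟨hS, hT.trans (le_of_eq ?_)⟩
  -- `Σ |q|^j (α j + β) = α Σ j|q|^j + β Σ |q|^j = α |q|∕(1−|q|)² + β∕(1−|q|)`
  have h1 : HasSum (fun j : ℕ => |q| ^ j) (1 / (1 - |q|)) := by
    rw [one_div]; exact hasSum_geometric_of_lt_one (abs_nonneg q) hq
  have h2 : HasSum (fun j : ℕ => (j : ℝ) * |q| ^ j) (|q| / (1 - |q|) ^ 2) := by
    have hs := summable_pow_mul_geometric_of_norm_lt_one 1 (show ‖|q|‖ < 1 by rwa [Real.norm_eq_abs, abs_abs])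
    simp only [pow_one] at hs
    have ht := tsum_coe_mul_geometric_of_norm_lt_one (𝕜 := ℝ) (show ‖|q|‖ < 1 by rwa [Real.norm_eq_abs, abs_abs])
    rw [← ht]
    exact hs.hasSum
  set α : ℝ := 2 * Real.log 3 / Real.log θ⁻¹ with hα
  set β : ℝ := 2 * (Real.posLog C / Real.log θ⁻¹ + 1) + 1 / (1 - θ) with hβ
  have e : ∀ j : ℕ, |q ^ j| * (2 * ((j * Real.log 3 + Real.posLog C) / Real.log θ⁻¹ + 1) + 1 / (1 - θ)) =
      α * ((j : ℝ) * |q| ^ j) + β * |q| ^ j := fun j => by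
    rw [abs_pow, hα, hβ]; field_simp; ring
  simp_rw [e]
  rw [((h2.mul_left α).add (h1.mul_left β)).tsum_eq]

end Summit.QuantumFields.YangMills.Theorems.BalabanUVNodesN19UniformMomentsChebyshevRoadPoisson

end
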